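import Mathlib
import HarnessLib
import HarnessLib.Audit
import Summits.BirchSwinnertonDyer.Statement
import Summits.BirchSwinnertonDyer.BirchSwinnertonDyer.Theorems.Rank1ResidualX9TwistCriterion
import Summits.BirchSwinnertonDyer.BirchSwinnertonDyer.Theorems.Rank1ResidualX9MuTransfer
import Summits.BirchSwinnertonDyer.Rank1Residual.X9.TwistStability
import Literature.NumberTheory.QuadraticFields.HurwitzClassNumberCongruences
import Summits.BirchSwinnertonDyer.BirchSwinnertonDyer.Theorems.PrintX9HowardRankOne
import Literature.NumberTheory.EllipticCurves.BurungaleCastellaSkinner2025.CyclotomicProductDivisibility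
import Literature.NumberTheory.EllipticCurves.BurungaleCastellaSkinner2025.GreenbergMuInvariantGoodReduction
import Literature.NumberTheory.EllipticCurves.BurungaleCastellaSkinner2025.OrdinaryGreenbergEquivalenceGuarded
import Literature.NumberTheory.EllipticCurves.BurungaleCastellaSkinner2025.ProductDivisibilities
import Literature.NumberTheory.EllipticCurves.CastellaGrossiSkinner2025.AnticyclotomicMainConjectures
import Literature.NumberTheory.EllipticCurves.CastellaGrossiSkinner2025.GreenbergPAdicLFunction
import Literature.NumberTheory.EllipticCurves.CastellaGrossiSkinner2025.PerrinRiouMainConjecture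
import Literature.NumberTheory.EllipticCurves.CastellaGrossiSkinner2025.TwoVariablePAdicLFunctionII
import Literature.NumberTheory.EllipticCurves.Hsieh2014.AnticyclotomicMuInvariant
import Literature.NumberTheory.EllipticCurves.JetchevSkinnerWan2017.AnticyclotomicControlGeneral
import Literature.NumberTheory.EllipticCurves.SkinnerUrban2014.ShapiroSelmerBigRep
import Literature.NumberTheory.EllipticCurves.MastellaZerman2026.HowardDivisibilityScalarImage
import Summits.BirchSwinnertonDyer.BirchSwinnertonDyer.Theorems.SignedLowerHalvesRealPeriodUnitPlusPeriod
import Summits.BirchSwinnertonDyer.BirchSwinnertonDyer.Theorems.InputsGreenbergCharValueRankZeroByName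
import Summits.BirchSwinnertonDyer.BirchSwinnertonDyer.Theorems.Rank1ResidualX9Defs
import HarnessLib.Audit.Status.Attr

/-!
Route: SignedBalanceX9

DORMANT since 2026-08-29T19:28:47Z (census g0: costume|duplicate of route-BirchSwinnertonDyer-SmallImageMuTransfer; reader census-reader-03-g0) — unstaffed, not closed; items shared with open routes are served there. `ledger route dormant <id> --off` reactivates.

# Route SignedBalanceX9 — Sign plus conservation — the mu-defect is nonnegative under analytic mu =
0 and sums to zero over an admissible twist quadruple (X9)

LINE (D-0145 ideator seat bsd-idea-2 g2, LINE 5; bears_on rung K6 = `Rank1Residual.BSDpOnClassX9`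
via its engine `Rank1Residual.IntegralMainConjectureOnClassX9`; no summit is proved by a line, BSD
is not proved). On class X9, BCS 2025 Thm 1.1.2(a) gives ch X = (g) with iota(g) = p^k L_p(f,alpha),
k in Z (tree fact, k : ℤ). Two facts about the integer k decide it: (SIGN, proved here) if
L_p(f,alpha) has a p-adic unit coefficient (analytic mu = 0) then k >= 0, because iota(g) has
coefficients in Z_p; (CONSERVATION, crux) over a BCS-admissible quadruple (E, E^K, E^F, E^KF) the
four defects sum to zero — the cyclotomic specialisation of BCS eq. (1.3), integral. Hence if E and
the three twists of ONE admissible pair (d_K,d_F) all have analytic mu = 0 (AnalyticMuZeroX9 =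
stmt-19630 for E; the tree conjecture (alpha-prime) `TwistedAnalyticMuZeroOnClassX9` for the
twists), all four k vanish: the integral main conjecture at E. It suffices to show
FourTermDefectBalanceX9 and the two analytic mu = 0 supplies; the separation (the route's Assembly)
is a theorem, kernel-checked in the seat folder, and the K6 kernel
`bsdpOnClassX9_of_integralMainConjectureOnClassX9` gives the leaf with the shared riders
PublishedInputsX9 (stmt-19632) and SchneiderX9RankOne (stmt-19631).
Lean: `FourTermDefectBalanceX9 → AnalyticMuZeroX9 → TwistedAnalyticMuZeroX9 → PublishedInputsX9 →
Summit.BirchSwinnertonDyer.BirchSwinnertonDyer.Rank1Residual.IntegralMainConjectureOnClassX9`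

## Assembly
The deciding theorem `closes (hAsm : Assembly) (hBal : FourTermDefectBalanceX9) (hMu :
AnalyticMuZeroX9) (hTw : TwistedAnalyticMuZeroX9) (hPub : PublishedInputsX9) (hSch :
SchneiderX9RankOne) : Rank1Residual.BSDpOnClassX9` feeds hIMC := hAsm hBal hMu hTw hPub and the
seven published conjuncts of hPub plus hSch to the K6 kernel
`Rank1Residual.bsdpOnClassX9_of_integralMainConjectureOnClassX9` (glueF.lean; SketchF.lean rc 0).
Inside the Assembly (PROVED in the seat folder, SketchF_proof.lean rc 0 sorries 0; lands as
Theorems/SignedBalanceX9Assembly.lean at birth): BCS (a) gives (g,k) at W and (g_i,k_i) at the three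
(alpha-prime) models, which are X9 by twist stability (dK, dF square-free and prime to p by
admissibility; dK dF square-free because primes of dF split in K); sign lemma four times; Balance;
omega.

CLOSES_TARGET: closes rung K6 of BirchSwinnertonDyer: Summit.BirchSwinnertonDyer.BirchSwinnertonDyer.Rank1Residual.BSDpOnClassX9 (D-0061; not the summit Statement) — the deciding theorem of this route concludes that registered leaf instead of the Statement decl `BirchSwinnertonDyer` (class rung: servable and labelled, never counted as concluding the summit Statement).

Rationale: WHY THIS LINE. Technique card «monotone quantity hunt», applied literally: the mu-defect k of BCS
(a) is ONE-SIDEDLY controlled for free — a unit coefficient of L_p forces k >= 0 (integrality of the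
characteristic power series), with no Euler system, no mu-transfer and no image hypothesis — and a
family of nonnegative integers with zero sum vanishes identically. The zero sum is base change:
BCS25 (arXiv:2405.00270) eq. (1.3) p.5, the product identity for (E, E^F) over the Z_p^2-extension
of an admissible K, specialised to the cyclotomic line and split by Shapiro into the four curves E,
E^K, E^F, E^KF (Greenberg 2016 Prop 4.1.1(b) no pseudo-null error; SkinnerUrban2014 3.2.11 control;
CastellaGrossiSkinner2023 Prop 1.2.4 descent). First-hand read (this seat, pp.2-5, 8): in print the
identity is in Lambda tensor Q_p only at non-(sur) pairs (Thm 1.2.2(a)/1.4.1(a)); the integral form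
is (sur) (How04 Thm B + BCK21 Thm 5.2) and, for dihedral images (5Ns/7Ns), the announced [BS24] (Rem
1.2.3) — so the Balance is XL today and print-shaped tomorrow, and even then BCS cannot descend to
Thm 1.1.2(b) on X9 because separating the cyclotomic factors integrally is Kato under (im): THIS
line is the (im)-free separation. What it does that the listed routes do not: TwinTransportX9 (this
seat, LINE 3/4) separates with a trivial rank-0 TWIN (unit L-VALUE, p prime to Tam, tors, Sha:
Prasanna's open problem, plus a Tamagawa residual) — here only unit COEFFICIENTS (mu = 0) are
needed, rank-free and Tamagawa-free, per pair a finite modular-symbol certificate (the lane's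
twist-face certificates, kit j246463, 8/8); the cell road TwistMuTransfer needs the mu-transfer Cor
5.7.2 (KatoMuTransfer) to get mu_alg = 0 at each twist — here mu_alg never enters;
SmallImageMuTransfer / PrintX9 transfer mu = 0 through a congruence f = g mod p to a big-image form
(MuTransfer 19629) — here the comparison is base change to K, not a congruence, and no big-image
partner is needed.

RANKED CRUXES. #2 FourTermDefectBalanceX9 (crux) — for an X9 pair (W,p), a BCS-admissible (dK,dF),
globally minimal models W1, W2, W3 of the twists W^dK, W^dF, W^(dK dF), cyclotomic data, newforms f,
f1, f2, f3 and BCS data (g_i, k_i) of the four cyclotomic Selmer duals (ch X_i = (g_i), iota(g_i) =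
p^(k_i) L_p(f_i, alpha_i)): k + k1 + k2 + k3 = 0. [difficulty: XL] (why it might fail: = BCS25
eq.(1.3) on the cyclotomic line, INTEGRAL, at a non-(sur) pair: printed only in Λ⊗Q_p (Thm
1.2.2(a)/1.4.1(a)); integral needs (sur) (How04 Thm B) or, for dihedral images, the announced
[BS24]; 5S4 (624/790 pairs) unplaced; a Howard/CGLS index shift at small image would make the sum
nonzero.) [arXiv:2405.00270, Greenberg2016, SkinnerUrban2014, CastellaGrossiSkinner2023, Howard2004]
#3 TwistedAnalyticMuZeroX9 (crux) — the tree conjecture (alpha-prime)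
`Rank1Residual.TwistedAnalyticMuZeroOnClassX9` by name: every X9 pair (W,p) has a BCS-admissible
(dK,dF) such that each of the three twists W^dK, W^dF, W^(dK dF) has a p-adic unit among the
coefficients of its p-adic L-function (analytic mu = 0 of the twists; per pair a finite
modular-symbol certificate). [difficulty: open-problem] (why it might fail: class-wide = Greenberg
Conj. 1.11 for the (again X9) twists; at fixed p no theorem gives even one twist with mu(L_p(E^d)) =
0 (Prasanna 2010 p.400 for unit values; Ono-Skinner/Chida: almost all p); the small image could
force p | theta(E^d) on the whole admissible orbit.) [Greenberg1999LNM1716,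
doi:10.4153/cjm-2010-023-2, OnoSkinner1998, arXiv:2405.00270]
#4 AnalyticMuZeroX9 (crux) — shared (= stmt-BirchSwinnertonDyer-19630 of SmallImageMuTransfer /
PrintX9, same signature): Greenberg's analytic mu = 0 on class X9 — every newform f of an X9 pair
has a p-adic unit coefficient in L_p(f, alpha). [difficulty: open-problem] (why it might fail:
Greenberg Conj. 1.11 is open class-wide; inside an isogeny class only some curve is predicted mu =
0, and although E[p] irreducible makes the lattice unique up to scalars, a small-image pair with
mu(theta) > 0 contradicts no theorem.) [Greenberg1999LNM1716, arXiv:2405.00270]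
#5 SchneiderX9RankOne (crux) — shared rider (= stmt-BirchSwinnertonDyer-19631, same signature):
Schneider non-degeneracy of the canonical p-adic height on the rank-1 X9 pairs, consumed by the K6
kernel. [difficulty: open-problem] (why it might fail: Schneider's conjecture is open for non-CM
curves; a rank-1 X9 pair with degenerate cyclotomic p-adic height is excluded by no theorem (barrier
PAdicHeightNondegeneracy).) [Schneider1985, PerrinRiou1993, arXiv:2405.00270]
#9 PublishedInputsX9 (support) — shared print bundle of rung K6 (= stmt-BirchSwinnertonDyer-19632,
same signature). [difficulty: provable-now] [arXiv:2405.00270, Greenberg1999LNM1716, Schneider1985,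
PerrinRiou1993]

TWO-LAYER PLAN. FourTermDefectBalanceX9 <= (B1) the integral anticyclotomic / two-variable equality
for E over an admissible K at a DIHEDRAL X9 pair ([BS24]-shape, to be cited as a Literature fact
when it appears) -> (B2) cyclotomic specialisation without pseudo-null error and the Shapiro /
period factorisation Omega(E/K) ~ Omega(E) Omega(E^K) up to p-units (Greenberg 2016 4.1.1(b),
SkinnerUrban2014 3.2.11, in-tree period facts) -> the four-term sum. TwistedAnalyticMuZeroX9 <=
per-pair certificates (instrument) -> a horizontal mu = 0 theorem for quadratic twists at fixed p
(Prasanna-shape weakened from unit values to unit coefficients). BC5 first rung (plan-only):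
stub_balance_sur : the four-term balance at a SURJECTIVE good ordinary pair from BCS Thm 1.4.1(b) +
Kato (where each k_i = 0 separately) — a consistency rung inside S's known regime, hence NOT a
witness; the honest witness is the dihedral case of (B1), pending [BS24].

KILL CRITERIA. A theorem placing a NONZERO index shift in the integral over-K equality at some X9
pair (Howard 2004 Thm B error term realised, or [BS24] appearing WITH a shift at dihedral primes)
refutes FourTermDefectBalanceX9 and closes the route (close --reason
refuted:FourTermDefectBalanceX9). A census X9 pair, or an admissible twist of one, with mu(theta_n)
> 0 certified for all n up to the Sturm-type bound kills the supply at that pair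
(refuted:TwistedAnalyticMuZeroX9 / AnalyticMuZeroX9 as class statements). Proof of
IntegralMainConjectureOnClassX9 elsewhere moots it; TwinTransportX9 closing first supersedes it on
the p-prime-to-Tam pairs only.

NOT DECOMPOSED YET. (B1)/(B2) of the Balance are not filed until T2 / the tribunal place [BS24] and
the Howard/CGLS shift (director W-67(b)); the real-quadratic twist E^F and the biquadratic one E^KF
are carried exactly as (alpha-prime) states them (no attempt to drop F: BCS need F for Wan's U(3,1)
input); no horizontal mu = 0 theorem is attempted in this generation.

CHEAPEST FALSIFIER. Per pair, in PARI/Magma modular symbols: for the smallest X9 pairs (324b1,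
324d1, 608b1, 608e1, 648a1 at p = 5) and their first BCS-admissible (dK, dF) (dK = -71, -191, ... at
N = 324), compute the first 3 coefficients of theta_2(E^d) for d in (dK, dF, dK dF) and look for a
unit: a quadruple with NO unit coefficient anywhere in range is a red flag for the supply; the
lane's twist-face certificates (KOLY-MEMO v1.7.1, kit j246463, 8/8 unit) are the existing rows.
Instrument row that would refute the key lemma: X9-MU-TABLE-v1 extended by (dK, dF, n_E, n_K, n_F,
n_KF) = first unit-coefficient indices; a row with a certified mu(theta(E^d)) > 0. The Balance
itself has no numerical falsifier (mu_alg is not computable); its falsifier is a printed shift (Kill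
criteria).

NUMBERS. X9 census (X9-MU-TABLE-v1): 790 pairs at N < 5*10^5, 624 of them 5S4, the rest 5Ns/7Ns
(dihedral, the [BS24] regime); residual-free: this line has NO Tamagawa or rank restriction
(TwinTransportX9 carried 144 p | Tam pairs as residual). Unit-coefficient certificates on record:
book230/250, N3 (31), twist face 8/8 (kit j246463), U1 21/21 — no exception wherever run.

DEFINITION REQUESTS. None: TwistHasUnitCoeff, BCSAdmissiblePair, ClassX9,
TwistedAnalyticMuZeroOnClassX9, AnalyticMuZeroOnClassX9, SelmerDualData, charIdeal,
iwasawaToPowerSeries, padicLFunction, unitRoot exist (SketchF.lean rc 0).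

Novelty: Searches (2026-08-28): lit search --hybrid "mu-invariant characteristic ideal p-adic L-function
equality up to power of p unit coefficient sign" (see NOTES); lit search "Burungale Skinner dihedral
main conjecture" (local: BCS only; crossref: none relevant — [BS24] announced, not out); lit galaxy
search "dihedral primes" --star pdf (0) and "Anticyclotomic Iwasawa theory of elliptic curves at
dihedral" --star all (0); first-hand read of arXiv:2405.00270 pp.2-5, 8, 11 (Thm 1.1.2, (im), Rem
1.1.3(iii), Thm 1.2.2, Rem 1.2.3 [BS24], Thm 1.4.1, eq.(1.3), Cor 4.1.4 proof); tree:
Rank1ResidualX9TwistCriterion (TwistMuTransfer, (alpha-prime), kernel), Rank1ResidualX9MuTransfer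
(AnalyticMuZeroOnClassX9, KatoMuTransfer), Theses SmallImageMuTransfer / PrintX9 /
OneSidedTwistSqueezeX9 / TwinTransportX9; ledger negatives --problem BirchSwinnertonDyer.
Nearest prior art found: the cell's kernel `integralMainConjectureOnClassX9_of_twistMuTransfer`
(TwistMuTransfer = four-term balance + KatoMuTransfer Cor 5.7.2 bundled as one conjecture-grade
node, + (alpha-prime)); this seat's TwinTransportX9 (two-term balance + trivial twin); BCS25 Thm
1.1.2(b) (separation by Kato under (im)).
Delta: the separation step is replaced by a SIGN — k >= 0 from a unit coefficient and integrality of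
the characteristic series, a two-line lemma — so that neither Kato under (im), nor a mu-transfer,
nor a trivial twin is needed: conservation (base change) + nonnegativity (analytic mu = 0 at four
curves) alone pin k = 0  [refs: 2405.00270]

Barriers (technique_class: iwasawa-main-conjecture, quadratic-twist, base-change): - technique_class: iwasawa-main-conjecture, quadratic-twist, base-change
- Literature.Barriers.BirchSwinnertonDyer.EulerSystemBigImageBarrier: the separation EVADES it (no
Kato/Kolyvagin divisibility with big image; the sign lemma is integrality of ch X only); the Balance
does NOT evade it today — the integral over-K equality at small image is exactly where Howard's
Kolyvagin-system argument needs (sur); the bet is [BS24] for dihedral images (BCS Rem 1.2.3) and the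
crux is declared XL.
- Literature.Barriers.BirchSwinnertonDyer.PAdicHeightBarrier: it does not, for the rank-1 half of
the K6 kernel: SchneiderX9RankOne (stmt-19631) rides as in every K6-kernel line; the separation and
the balance use no p-adic height.
- Literature.Barriers.BirchSwinnertonDyer.EisensteinMuBarrier: outside — X9 is residually
irreducible (p >= 5), the lattice is unique up to scalars so mu(L_p) is well defined, and mu = 0 is
asked only on the ANALYTIC side (certifiable), never transferred.
- Literature.Barriers.BirchSwinnertonDyer.ExceptionalZeroBarrier: outside — good ordinary p
throughout (ClassX9 and twist stability: p does not divide dK dF).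
- Literature.Barriers.BirchSwinnertonDyer.ExceptionalZeroBarrierNarrow: outside — same reason;
L_p(f,alpha) only at good ordinary p.
- Literature.Barriers.BirchSwinnertonDyer.HeegnerPointBarrier: outside — the leaf is analytic rank
<= 1; no Heegner point is used by this line at all (the over-K input is a characteristic-ideal
identity).
- Literature.Barriers.Bi

History (route lifecycle, newest last):
- 2026-08-29T19:28:47Z · DORMANT — census g0: costume|duplicate of route-BirchSwinnertonDyer-SmallImageMuTransfer; reader census-reader-03-g0 (operator:999:983790)

sub-problem: BirchSwinnertonDyer · status: dormant · opened planner-bsd-idea-2-g2-0 2026-08-28T01:34:45Z · rev 12 · ledger route-BirchSwinnertonDyer-SignedBalanceX9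
GENERATED by the gate from the ledger (D-0016/17). Provers cite these decls: `theorem foo : Summit.BirchSwinnertonDyer.BirchSwinnertonDyer.Theses.SignedBalanceX9.<Decl> := …` in Summits/BirchSwinnertonDyer/BirchSwinnertonDyer/Theorems/<Name>.lean.
-/

namespace Summit.BirchSwinnertonDyer.BirchSwinnertonDyer.Theses.SignedBalanceX9

open scoped BigOperators Topology Manifold Classical MeasureTheory ProbabilityTheory Matrix InnerProductSpace ComplexConjugate ContinuousMap
open Filter Set Function TopologicalSpace MeasureTheory

attribute [summit_statement] _root_.BirchSwinnertonDyer
attribute [summit_statement] _root_.Summit.BirchSwinnertonDyer.BirchSwinnertonDyer.Rank1Residual.BSDpOnClassX9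

open Literature

/-- item stmt-BirchSwinnertonDyer-25216 · crux · rank 2 · open · by planner
why it might fail: (U) = Greenberg mu=0 on X9 twists (open; odd-sign members need a coefficient n ≥ 1); (K) with 2 split is not in print: BRR 2023 Thm 1 covers odd split sets only (classification proved for odd cube-free modulus) — a mod-p Ramanujan-type congruence for H on an 8-divisible progression would block it.
sources: arXiv:2305.19272 Thm 1, Thm 3, Remark 1, §4 (proof of Thm 1 p.14), arXiv:1612.04443 p.4 (Wiles 2015 JLMS 92 as quoted; Thm 1.1, Cor 1.2), arXiv:2405.00270 Lemma 5.2.3, Thm 1.1.2(a), GreenbergLNM1716 Conj. 1.11, arXiv:2505.08710 Cor 4.6 (tree: X9.heegnerContainment_of_cor46), pub/ideators/bsd-idea-2/line5/FOUR-CERT-v1.txt (kit j296987)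
[crux] TWISTED ANALYTIC mu = 0 AT A COPRIME ADMISSIBLE FRAME: for every X9 pair (W,p) there is a
BCS-admissible (d_K,d_F) such that p does not divide the class number of the imaginary quadratic
field of discriminant d_K (for every number field K, IsImaginaryQuadratic K → discr K = d_K → ¬ p ∣
classNumber K) and the cyclotomic p-adic L-functions of (globally minimal models of) W^{d_K},
W^{d_F}, W^{d_K d_F} each have a coefficient of p-adic norm 1 (TwistHasUnitCoeff). Skeleton (BC3,
proved composition): (F) the d_F side exists by Dirichlet/CRT (BCS25 Lemma 5.2.3); (K) for p ≥ 5 and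
any M > 0 there is a negative fundamental d ≡ 1 (mod 4), d ≠ -3, with every prime l | M and p split
and p ∤ h(d) — PRINT for odd M (Beckwith–Raum–Richter 2023 Thm 1: any finite set of odd split
primes, p itself allowed), the 2-adic case (d ≡ 1 mod 8, needed since 4 | N for 7 of the 8 small X9
conductors) is the print gap; (U) Greenberg mu = 0 (a unit coefficient) for the prime-to-p
square-free quadratic twists of an X9 curve (they are X9 again). Implies the plain supply stmt-24460
(one line). Instrument COPRIME-FRAME-v1 (seat folder): 14/14 small pairs have a coprime FIRST
admissible d_K; FOUR-CERT-v1 (kit -/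
@[route_item "route-BirchSwinnertonDyer-SignedBalanceX9"]
def TwistedAnalyticMuZeroCoprimeX9 : Prop :=
  ∀ (W : WeierstrassCurve ℚ) [W.IsElliptic] [W.IsGloballyMinimal] (p : ℕ) [Fact p.Prime], Summit.BirchSwinnertonDyer.BirchSwinnertonDyer.Rank1Residual.ClassX9 W p → ∃ dK dF : ℤ, Summit.BirchSwinnertonDyer.BirchSwinnertonDyer.Rank1Residual.BCSAdmissiblePair W p dK dF ∧ (∀ (K : Type) [Field K] [NumberField K], Literature.NumberTheory.EllipticCurves.IsImaginaryQuadratic K → NumberField.discr K = dK → ¬ p ∣ NumberField.classNumber K) ∧ Summit.BirchSwinnertonDyer.BirchSwinnertonDyer.Rank1Residual.TwistHasUnitCoeff W p dK ∧ Summit.BirchSwinnertonDyer.BirchSwinnertonDyer.Rank1Residual.TwistHasUnitCoeff W p dF ∧ Summit.BirchSwinnertonDyer.BirchSwinnertonDyer.Rank1Residual.TwistHasUnitCoeff W p (dK * dF)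

/-- item stmt-BirchSwinnertonDyer-19630 · crux · rank 4 · open · by planner
why it might fail: Greenberg Conj. 1.11 is open class-wide; inside an isogeny class only some curve is predicted mu = 0, and although E[p] irreducible makes the lattice unique up to scalars, a small-image pair with mu(theta) > 0 contradicts no theorem.
sources: Greenberg1999LNM1716, arXiv:2405.00270
[crux] Greenberg's μ = 0 on the ANALYTIC side for class X9, by name the tree's
`Rank1Residual.AnalyticMuZeroOnClassX9`: for every X9 pair (E, p) and every newform f of E, some
coefficient of L_p(f, α, T) ∈ ℤ_p⟦T⟧ is a p-adic unit (L_p ∉ pΛ). Class-wide OPEN (Greenberg LNM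
1716 Conj. 1.11 is stated on the algebraic side; under the main conjecture the two agree); per pair
a finite exact modular-symbol computation — RECORDS OF RECORD (REF-KOLY-VERDICT v5-1 GAP 1 /
residual R1, corrected here): book230 0 open cells ‖ 250 (26 Greenberg–Vatsal transports +
unit-coefficient certificates), N3 two-engine μ-certificates (31 instances), KOLY-MEMO v1.7.1 twist
face 8/8 (kit j246463), U1 21/21 CM pairs; the class-wide census counts 790 X9 pairs at N < 5·10⁵
(624 of them 5S4, the rest 5Ns/7Ns — KOLY-MEMO l.115 / X9-IMAGE-SHAPE-G3 §3b; 91 with a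
good-ordinary CM elliptic-curve partner over ℚ; 155682e1 and 229842h1, both N > 30 000, have no
congruent partner) — no exception wherever a certificate was run, and NO class-wide 790-pair
certification on record (the earlier «all 790 pairs of conductor ≤ 30 000» wording is withdrawn).
SPLIT D1 (rev 4): ⟸ MuZeroCMCurves ∧ AnalyticMuZeroX9NoCMPartner ∧ MuS -/
@[route_item "route-BirchSwinnertonDyer-SignedBalanceX9", crux]
def AnalyticMuZeroX9 : Prop :=
  Summit.BirchSwinnertonDyer.BirchSwinnertonDyer.Rank1Residual.AnalyticMuZeroOnClassX9

/-- item stmt-BirchSwinnertonDyer-19631 · crux · rank 5 · open · by planner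
why it might fail: Schneider's conjecture is open for non-CM curves; a rank-1 X9 pair with degenerate cyclotomic p-adic height is excluded by no theorem (barrier PAdicHeightNondegeneracy).
sources: Schneider1985, PerrinRiou1993, arXiv:2405.00270
[crux] Schneider's conjecture on the rank-1 part of X9: for every X9 pair (E, p) of analytic rank 1
and every CANONICAL p-adic height datum Dh on E at p, the cyclotomic p-adic height pairing is
non-degenerate (Reg_p ≠ 0) — the binder hC3 of the kernel bridge; by Perrin-Riou's p-adic
Gross–Zagier it is equivalent to ord_T L_p(f, α, T) = 1 on these pairs. [difficulty: L] -/
@[route_item "route-BirchSwinnertonDyer-SignedBalanceX9", crux]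
def SchneiderX9RankOne : Prop :=
  ∀ (W : WeierstrassCurve ℚ) [W.IsElliptic] [W.IsGloballyMinimal] (p : ℕ) [Fact p.Prime], Summit.BirchSwinnertonDyer.BirchSwinnertonDyer.Rank1Residual.ClassX9 W p → W.analyticRank = 1 → ∀ Dh : WeierstrassCurve.PAdicHeightData W p, Dh.IsCanonical → WeierstrassCurve.SchneiderConjecture Dh

/-- item stmt-BirchSwinnertonDyer-25217 · crux · rank 9 · open · by planner
sources: arXiv:2505.08710 Cor 4.6, arXiv:2405.00270 eq.(1.3), Thm 1.2.4, Prop 5.2.1, Thm 4.1.3, Hsieh2014 (Doc. Math. 19) Thm B, CastellaGrossiSkinner2025 Prop 1.3.1, 1.4.5, 2.2.1, SkinnerUrban2014 Lemma 3.1.7, Prop 3.2.8, 3.2.11, GreenbergSelmerStructure2016 Prop 4.1.1(b)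
[support, PRINT ∧ MEMO] the ONE-SIDED four-term defect inequality k + k1 + k2 + k3 ≤ 0 of stmt-24566
(FourTermDefectUpperX9) restricted to COPRIME admissible frames: same binders plus the hypothesis
that p does not divide the class number of the imaginary quadratic field of discriminant d_K. At
such frames Howard's anticyclotomic containment is Mastella–Zerman 2026 Cor 4.6 at p-adic scalar
image (tree: X9.heegnerContainment_of_cor46 / ClassX9.exists_heegnerContainment_of_cor46, cite-only
named fact h46) instead of crux A (stmt-23161, any class number), and the remaining passage is
stmt-24708's (W) BCS25 Prop 5.2.1 / Hsieh 2014 mu(L^BDP)=0, (H) BCK21 5.2 + CGS23 1.4.5/1.3.1, (R)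
SU14 Lemma 3.1.7, (S) SU14 3.2.8/3.2.11 + Gre16 4.1.1(b), (F) CGS23 2.2.1 Shapiro — all printed
under p ∤ h_K or class-number-free (DOSSIER §48.3; critic NOTE 27c(a)). Implied by 24566 (one line).
Formalisation XL (two-variable Lambda_K Selmer duals are not yet tree notions — typer ask
outstanding); not a crux: no step is beyond print at p ∤ h_K. -/
@[route_item "route-BirchSwinnertonDyer-SignedBalanceX9", crux]
def FourTermDefectUpperCoprimeX9 : Prop :=
  ∀ (W : WeierstrassCurve ℚ) [W.IsElliptic] [W.IsGloballyMinimal] (p : ℕ) [Fact p.Prime] (dK dF : ℤ), Summit.BirchSwinnertonDyer.BirchSwinnertonDyer.Rank1Residual.ClassX9 W p → Summit.BirchSwinnertonDyer.BirchSwinnertonDyer.Rank1Residual.BCSAdmissiblePair W p dK dF → (∀ (K : Type) [Field K] [NumberField K], Literature.NumberTheory.EllipticCurves.IsImaginaryQuadratic K → NumberField.discr K = dK → ¬ p ∣ NumberField.classNumber K) → ∀ (W₁ W₂ W₃ : WeierstrassCurve ℚ) [W₁.IsElliptic] [W₁.IsGloballyMinimal] [W₂.IsElliptic] [W₂.IsGloballyMinimal]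 [W₃.IsElliptic] [W₃.IsGloballyMinimal], (∃ C : WeierstrassCurve.VariableChange ℚ, C • W₁ = W.quadraticTwist (dK : ℚ)) → (∃ C : WeierstrassCurve.VariableChange ℚ, C • W₂ = W.quadraticTwist (dF : ℚ)) → (∃ C : WeierstrassCurve.VariableChange ℚ, C • W₃ = W.quadraticTwist ((dK * dF : ℤ) : ℚ)) → ∀ (κ : Literature.NumberTheory.EllipticCurves.ZpExtension ℚ p) (γ : Field.absoluteGaloisGroup ℚ) {N : ℕ} [NeZero N] (f : CuspForm (CongruenceSubgroup.Gamma0 N) 2) {N₁ : ℕ} [NeZero N₁] (f₁ : CuspForm (CongruenceSubgroup.Gamma0 N₁) 2) {N₂ : ℕ} [NeZero N₂] (f₂ : CuspForm (CongruenceSubgroup.Gamma0 N₂) 2) {N₃ : ℕ} [NeZero N₃] (f₃ : CuspForm (CongruenceSubgroup.Gamma0 N₃) 2), κ.IsCyclotomic → κ.IsTopGenerator γ → Literature.NumberTheory.EllipticCurves.IsCyclotomicVariable p γ → Literature.NumberTheory.EllipticCurves.ModularForms.IsNewformOf W f → Literature.NumberTheory.EllipticCurves.ModularForms.IsNewformOf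 W₁ f₁ → Literature.NumberTheory.EllipticCurves.ModularForms.IsNewformOf W₂ f₂ → Literature.NumberTheory.EllipticCurves.ModularForms.IsNewformOf W₃ f₃ → ∀ (D : W.SelmerDualData κ γ) (D₁ : W₁.SelmerDualData κ γ) (D₂ : W₂.SelmerDualData κ γ) (D₃ : W₃.SelmerDualData κ γ) (k k₁ k₂ k₃ : ℤ), (∃ g : Literature.NumberTheory.EllipticCurves.IwasawaAlgebra p, D.charIdeal = Ideal.span {g} ∧ Literature.NumberTheory.EllipticCurves.iwasawaToPowerSeries p g = PowerSeries.C ((p : ℚ_[p]) ^ k) * Literature.NumberTheory.EllipticCurves.padicLFunction f (Literature.NumberTheory.EllipticCurves.unitRoot W p : ℚ_[p])) → (∃ g : Literature.NumberTheory.EllipticCurves.IwasawaAlgebra p, D₁.charIdeal = Ideal.span {g} ∧ Literature.NumberTheory.EllipticCurves.iwasawaToPowerSeries p g = PowerSeries.C ((p : ℚ_[p]) ^ k₁) * Literature.NumberTheory.EllipticCurves.padicLFunction f₁ (Literature.NumberTheory.EllipticCurves.unitRoot W₁ p : ℚ_[p])) → (∃ g : Literature.NumberTheory.EllipticCurves.IwasawaAlgebra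 p, D₂.charIdeal = Ideal.span {g} ∧ Literature.NumberTheory.EllipticCurves.iwasawaToPowerSeries p g = PowerSeries.C ((p : ℚ_[p]) ^ k₂) * Literature.NumberTheory.EllipticCurves.padicLFunction f₂ (Literature.NumberTheory.EllipticCurves.unitRoot W₂ p : ℚ_[p])) → (∃ g : Literature.NumberTheory.EllipticCurves.IwasawaAlgebra p, D₃.charIdeal = Ideal.span {g} ∧ Literature.NumberTheory.EllipticCurves.iwasawaToPowerSeries p g = PowerSeries.C ((p : ℚ_[p]) ^ k₃) * Literature.NumberTheory.EllipticCurves.padicLFunction f₃ (Literature.NumberTheory.EllipticCurves.unitRoot W₃ p : ℚ_[p])) → k + k₁ + k₂ + k₃ ≤ 0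

/-- item stmt-BirchSwinnertonDyer-24459 · aside · rank 2 · open · by planner
why it might fail: = memo KOLY Prop 5.8.C(i) typed standalone (four-term, every admissible pair, any V(E)): cell theorem on paper (REF PASS v5 'modulo printed inputs'), not print. Breakable inputs: Cor 4.2(b)=BCK21 3.1 at (irr) (tree fact adds p∤h_K); Gre16 4.1.1(b) LEO/CRK; SU14 3.2.11 equality (no μ in X_pn[I⁻]).
sources: pub/bsd-smallim/koly/KOLY-MEMO.md Prop 5.8.C(i) l.1520-1523, Lemmas 5.8.A/B, Cor 4.2(b); REF-KOLY-VERDICT §5.8 PASS v5 l.1167-1186, arXiv:2405.00270 Thm 1.4.1(a), eq.(1.1)-(1.3) p.5, Prop 5.2.1, Lemma 5.2.3, Thm 4.1.3, Cor 4.1.4, Prop 4.2.2, BurungaleCastellaKim2021 Thm 3.1, GreenbergSelmerStructure2016 Prop 4.1.1(b) + §4.3, SkinnerUrban2014 Prop 3.2.3, 3.2.8, Cor 3.2.9(ii), Prop 3.2.11, CastellaGrossiSkinner2025 Prop 1.2.4, Prop 2.2.1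
[crux] for an X9 pair (W,p), a BCS-admissible (dK,dF), globally minimal models W1, W2, W3 of the
twists W^dK, W^dF, W^(dK dF), cyclotomic data, newforms f, f1, f2, f3 and BCS data (g_i, k_i) of the
four cyclotomic Selmer duals (ch X_i = (g_i), iota(g_i) = p^(k_i) L_p(f_i, alpha_i)): k + k1 + k2 +
k3 = 0. [difficulty: XL] -/
@[route_item "route-BirchSwinnertonDyer-SignedBalanceX9"]
def FourTermDefectBalanceX9 : Prop :=
  ∀ (W : WeierstrassCurve ℚ) [W.IsElliptic] [W.IsGloballyMinimal] (p : ℕ) [Fact p.Prime] (dK dF : ℤ), Summit.BirchSwinnertonDyer.BirchSwinnertonDyer.Rank1Residual.ClassX9 W p → Summit.BirchSwinnertonDyer.BirchSwinnertonDyer.Rank1Residual.BCSAdmissiblePair W p dK dF → ∀ (W₁ W₂ W₃ : WeierstrassCurve ℚ) [W₁.IsElliptic] [W₁.IsGloballyMinimal] [W₂.IsElliptic] [W₂.IsGloballyMinimal] [W₃.IsElliptic] [W₃.IsGloballyMinimal], (∃ C : WeierstrassCurve.VariableChange ℚ, C • W₁ = W.quadraticTwist (dK : ℚ)) → (∃ C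 : WeierstrassCurve.VariableChange ℚ, C • W₂ = W.quadraticTwist (dF : ℚ)) → (∃ C : WeierstrassCurve.VariableChange ℚ, C • W₃ = W.quadraticTwist ((dK * dF : ℤ) : ℚ)) → ∀ (κ : Literature.NumberTheory.EllipticCurves.ZpExtension ℚ p) (γ : Field.absoluteGaloisGroup ℚ) {N : ℕ} [NeZero N] (f : CuspForm (CongruenceSubgroup.Gamma0 N) 2) {N₁ : ℕ} [NeZero N₁] (f₁ : CuspForm (CongruenceSubgroup.Gamma0 N₁) 2) {N₂ : ℕ} [NeZero N₂] (f₂ : CuspForm (CongruenceSubgroup.Gamma0 N₂) 2) {N₃ : ℕ} [NeZero N₃] (f₃ : CuspForm (CongruenceSubgroup.Gamma0 N₃) 2), κ.IsCyclotomic → κ.IsTopGenerator γ → Literature.NumberTheory.EllipticCurves.IsCyclotomicVariable p γ → Literature.NumberTheory.EllipticCurves.ModularForms.IsNewformOf W f → Literature.NumberTheory.EllipticCurves.ModularForms.IsNewformOf W₁ f₁ → Literature.NumberTheory.EllipticCurves.ModularForms.IsNewformOf W₂ f₂ → Literature.NumberTheory.EllipticCurves.ModularForms.IsNewformOf W₃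 f₃ → ∀ (D : W.SelmerDualData κ γ) (D₁ : W₁.SelmerDualData κ γ) (D₂ : W₂.SelmerDualData κ γ) (D₃ : W₃.SelmerDualData κ γ) (k k₁ k₂ k₃ : ℤ), (∃ g : Literature.NumberTheory.EllipticCurves.IwasawaAlgebra p, D.charIdeal = Ideal.span {g} ∧ Literature.NumberTheory.EllipticCurves.iwasawaToPowerSeries p g = PowerSeries.C ((p : ℚ_[p]) ^ k) * Literature.NumberTheory.EllipticCurves.padicLFunction f (Literature.NumberTheory.EllipticCurves.unitRoot W p : ℚ_[p])) → (∃ g : Literature.NumberTheory.EllipticCurves.IwasawaAlgebra p, D₁.charIdeal = Ideal.span {g} ∧ Literature.NumberTheory.EllipticCurves.iwasawaToPowerSeries p g = PowerSeries.C ((p : ℚ_[p]) ^ k₁) * Literature.NumberTheory.EllipticCurves.padicLFunction f₁ (Literature.NumberTheory.EllipticCurves.unitRoot W₁ p : ℚ_[p])) → (∃ g : Literature.NumberTheory.EllipticCurves.IwasawaAlgebra p, D₂.charIdeal = Ideal.span {g} ∧ Literature.NumberTheory.EllipticCurves.iwasawaToPowerSeries p g = PowerSeries.C ((p : ℚ_[p])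 ^ k₂) * Literature.NumberTheory.EllipticCurves.padicLFunction f₂ (Literature.NumberTheory.EllipticCurves.unitRoot W₂ p : ℚ_[p])) → (∃ g : Literature.NumberTheory.EllipticCurves.IwasawaAlgebra p, D₃.charIdeal = Ideal.span {g} ∧ Literature.NumberTheory.EllipticCurves.iwasawaToPowerSeries p g = PowerSeries.C ((p : ℚ_[p]) ^ k₃) * Literature.NumberTheory.EllipticCurves.padicLFunction f₃ (Literature.NumberTheory.EllipticCurves.unitRoot W₃ p : ℚ_[p])) → k + k₁ + k₂ + k₃ = 0

/-- item stmt-BirchSwinnertonDyer-24566 · aside · rank 2 · SPLIT (gen 1) into HowardContainmentAnyClassNumber, UpperOfHowardContainment + glue UpperOfSplit · direct attempts still welcome (low priority) · by planner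
why it might fail: Beyond print: integral anticyclotomic input at (irr) = memo Cor 4.2(b)/BCK21 3.1 (tree fact adds p∤h_K); two-variable passage = BCS Thm 1.2.4 argument (integral only under (sur) in print); specialisation needs Gre16 4.1.1(b) LEO/CRK (memo 5.8.B). An integral Howard/CGLS shift at an X9 pair breaks it
sources: arXiv:2405.00270 eq.(1.3) p.5, Thm 1.2.4, Thm 4.2.1, Prop 5.2.1, Lemma 5.2.3, Thm 4.1.3, Cor 4.1.4, BurungaleCastellaKim2021 Thm 3.1 (tree: Literature.NumberTheory.EllipticCurves.BurungaleCastellaKim2021.thm31_howardThmB_of_irreducible), GreenbergSelmerStructure2016 Prop 4.1.1(b) + §4.3, SkinnerUrban2014 Prop 3.2.3, 3.2.8, Cor 3.2.9(ii), Prop 3.2.11, CastellaGrossiSkinner2025 Prop 1.2.4, Prop 2.2.1, pub/bsd-smallim/koly/KOLY-MEMO.md Prop 5.8.C(i), Lemmas 5.8.A/B, Cor 4.2(b); REF-KOLY-VERDICT §5.8 PASS v5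
[crux] ONE-SIDED four-term defect inequality on X9: for an X9 pair (W,p), a BCS-admissible (dK,dF),
globally minimal models W1,W2,W3 of W^dK, W^dF, W^(dK dF), cyclotomic data, newforms and BCS data
(g_i,k_i) with ch X_i = (g_i), iota(g_i) = p^(k_i) L_p(f_i): k + k1 + k2 + k3 <= 0. This is the
EULER-SYSTEM (Selmer upper-bound) half of the integral product identity BCS25 eq.(1.3) for (E, E^F)
over K, specialised to the cyclotomic line and Shapiro-split over the four curves; the other half
(>= 0) is BCS25 Prop 5.2.1's integral direction and is REDUNDANT here (the sign lemma gives each k_i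
>= 0 under analytic mu = 0). Why it might fail: beyond print — the integral anticyclotomic input at
(irr) is memo Cor 4.2(b) = BCK21 Thm 3.1 (tree fact
`BurungaleCastellaKim2021.thm31_howardThmB_of_irreducible`, with extra p∤h_K), the two-variable
passage is BCS Thm 1.2.4's argument (printed rational at (irr), integral at (sur)), and the
cyclotomic specialisation needs no-pseudo-null (Gre16 4.1.1(b): LEO/CRK discharged only in memo
5.8.B) — a Howard/CGLS-type index shift realised integrally at some X9 pair makes the sum positive.
Difficulty L (memo-grade: KOLY Prop 5.8.C(i) gives even = 0). -/
@[route_item "route-BirchSwinnertonDyer-SignedBalanceX9"]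
def FourTermDefectUpperX9 : Prop :=
  ∀ (W : WeierstrassCurve ℚ) [W.IsElliptic] [W.IsGloballyMinimal] (p : ℕ) [Fact p.Prime] (dK dF : ℤ), Summit.BirchSwinnertonDyer.BirchSwinnertonDyer.Rank1Residual.ClassX9 W p → Summit.BirchSwinnertonDyer.BirchSwinnertonDyer.Rank1Residual.BCSAdmissiblePair W p dK dF → ∀ (W₁ W₂ W₃ : WeierstrassCurve ℚ) [W₁.IsElliptic] [W₁.IsGloballyMinimal] [W₂.IsElliptic] [W₂.IsGloballyMinimal] [W₃.IsElliptic] [W₃.IsGloballyMinimal], (∃ C : WeierstrassCurve.VariableChange ℚ, C • W₁ = W.quadraticTwist (dK : ℚ)) → (∃ C : WeierstrassCurve.VariableChange ℚ, C • W₂ = W.quadraticTwist (dF : ℚ)) → (∃ C : WeierstrassCurve.VariableChange ℚ, C • W₃ = W.quadraticTwist ((dK * dF : ℤ) : ℚ)) → ∀ (κ : Literature.NumberTheory.EllipticCurves.ZpExtension ℚ p) (γ : Field.absoluteGaloisGroup ℚ) {N : ℕ} [NeZero N] (f : CuspForm (CongruenceSubgroup.Gamma0 N) 2) {N₁ : ℕ}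 [NeZero N₁] (f₁ : CuspForm (CongruenceSubgroup.Gamma0 N₁) 2) {N₂ : ℕ} [NeZero N₂] (f₂ : CuspForm (CongruenceSubgroup.Gamma0 N₂) 2) {N₃ : ℕ} [NeZero N₃] (f₃ : CuspForm (CongruenceSubgroup.Gamma0 N₃) 2), κ.IsCyclotomic → κ.IsTopGenerator γ → Literature.NumberTheory.EllipticCurves.IsCyclotomicVariable p γ → Literature.NumberTheory.EllipticCurves.ModularForms.IsNewformOf W f → Literature.NumberTheory.EllipticCurves.ModularForms.IsNewformOf W₁ f₁ → Literature.NumberTheory.EllipticCurves.ModularForms.IsNewformOf W₂ f₂ → Literature.NumberTheory.EllipticCurves.ModularForms.IsNewformOf W₃ f₃ → ∀ (D : W.SelmerDualData κ γ) (D₁ : W₁.SelmerDualData κ γ) (D₂ : W₂.SelmerDualData κ γ) (D₃ : W₃.SelmerDualData κ γ) (k k₁ k₂ k₃ : ℤ), (∃ g : Literature.NumberTheory.EllipticCurves.IwasawaAlgebra p, D.charIdeal = Ideal.span {g} ∧ Literature.NumberTheory.EllipticCurves.iwasawaToPowerSeries p g = PowerSeries.C ((p : ℚ_[p]) ^ k)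 * Literature.NumberTheory.EllipticCurves.padicLFunction f (Literature.NumberTheory.EllipticCurves.unitRoot W p : ℚ_[p])) → (∃ g : Literature.NumberTheory.EllipticCurves.IwasawaAlgebra p, D₁.charIdeal = Ideal.span {g} ∧ Literature.NumberTheory.EllipticCurves.iwasawaToPowerSeries p g = PowerSeries.C ((p : ℚ_[p]) ^ k₁) * Literature.NumberTheory.EllipticCurves.padicLFunction f₁ (Literature.NumberTheory.EllipticCurves.unitRoot W₁ p : ℚ_[p])) → (∃ g : Literature.NumberTheory.EllipticCurves.IwasawaAlgebra p, D₂.charIdeal = Ideal.span {g} ∧ Literature.NumberTheory.EllipticCurves.iwasawaToPowerSeries p g = PowerSeries.C ((p : ℚ_[p]) ^ k₂) * Literature.NumberTheory.EllipticCurves.padicLFunction f₂ (Literature.NumberTheory.EllipticCurves.unitRoot W₂ p : ℚ_[p])) → (∃ g : Literature.NumberTheory.EllipticCurves.IwasawaAlgebra p, D₃.charIdeal = Ideal.span {g} ∧ Literature.NumberTheory.EllipticCurves.iwasawaToPowerSeries p g = PowerSeries.C ((p : ℚ_[p]) ^ k₃) * Literature.NumberTheory.EllipticCurves.padicLFunction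 f₃ (Literature.NumberTheory.EllipticCurves.unitRoot W₃ p : ℚ_[p])) → k + k₁ + k₂ + k₃ ≤ 0

-- parent: FourTermDefectUpperX9 · child (gen 1)
/--     item stmt-BirchSwinnertonDyer-23161 · aside · rank 201 · open
    parent: FourTermDefectUpperX9 · by planner
    why it might fail: when K_inf ∩ H_K ≠ K the norm-point Heegner family generates a proper submodule of the CGLS enlarged module, so heegnerCharIdeal may exceed char(Sel/Λκ1) by a factor at (p, γ−1); MZ26 Cor 4.6 prints it only under p ∤ h_K and scalars 1+pZ_p in the p-adic image.
    sources: arXiv:2505.08710, arXiv:2008.02571, arXiv:1908.09512, Howard2004HeegnerKolyvagin, doi:10.1112/S0010437X12000619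
[crux] for every X9 pair (E,p) (p ≥ 5 good ordinary, E[p] irreducible with non-surjective image,
non-CM), every imaginary quadratic K with d_K ∉ {−3,−4} satisfying the Heegner hypothesis for N_E
and for p (p split), every anticyclotomic ℤ_p-extension datum (κ, γ) and every modular
parametrisation / Heegner datum, there exist the Λ-adic Selmer data, a Heegner family (in the tree's
sense) and a Selmer dual with heegnerCharIdeal² ≤ char(X_tors) — Howard's Theorem B containment —
with NO hypothesis on the class number of K (the landed `X9.heegnerContainment_of_cor46` is exactly
this with `¬ p ∣ classNumber K` added, from Mastella–Zerman Cor. 4.6). [difficulty: L] -/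
@[route_item "route-BirchSwinnertonDyer-SignedBalanceX9"]
def HowardContainmentAnyClassNumber : Prop :=
  ∀ (W : WeierstrassCurve ℚ) [W.IsElliptic] [W.IsGloballyMinimal] (p : ℕ) [Fact p.Prime] [NeZero (W.conductorNorm ℤ)] (K : Type) [Field K] [NumberField K], Summit.BirchSwinnertonDyer.BirchSwinnertonDyer.Rank1Residual.ClassX9 W p → Literature.NumberTheory.EllipticCurves.IsImaginaryQuadratic K → NumberField.discr K ≠ -3 → NumberField.discr K ≠ -4 → Literature.NumberTheory.EllipticCurves.SatisfiesHeegnerHypothesis (W.conductorNorm ℤ) K → Literature.NumberTheory.EllipticCurves.SatisfiesHeegnerHypothesis p K → ∀ (κ : Literature.NumberTheory.EllipticCurves.ZpExtension K p), κ.IsAnticyclotomic → ∀ (γ : Field.absoluteGaloisGroup K), κ.IsTopGenerator γ → ∀ (Dt : Literature.NumberTheory.EllipticCurves.ModularForms.ModularParametrizationData W (W.conductorNorm ℤ)) (H : Literature.NumberTheory.EllipticCurves.HeegnerDatum (W.conductorNorm ℤ) (NumberField.discr K)) (ιC : K →+* ℂ), ∃ (jbar : AlgebraicClosure K →+* ℂ)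 (D : (W.baseChange K).LambdaAdicSelmerData κ γ) (F : Literature.NumberTheory.EllipticCurves.HeegnerFamily (W.conductorNorm ℤ) W K κ jbar) (X : (W.baseChange K).SelmerDualData κ γ), Literature.NumberTheory.EllipticCurves.heegnerCharIdeal D F ^ 2 ≤ Literature.NumberTheory.EllipticCurves.Module.charIdeal (Literature.NumberTheory.EllipticCurves.IwasawaAlgebra p) (Submodule.torsion (Literature.NumberTheory.EllipticCurves.IwasawaAlgebra p) X.X)

-- parent: FourTermDefectUpperX9 · child (gen 1)
/--     item stmt-BirchSwinnertonDyer-24708 · aside · rank 202 · open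
    parent: FourTermDefectUpperX9 · by planner
    why it might fail: the Howard-form ⇒ Greenberg-form conversion (BCK21 5.2) and SU14 3.1.7 need mu(L^BDP)=0 (Hsieh 2014; class-number clause?) — at p | h_K frames the passage may be beyond print; Gre16 4.1.1(b) needs X Λ_K-torsion with no pseudo-null submodule (memo 5.8.B).
    sources: arXiv:2405.00270, arXiv:1908.09512, doi:10.1007/s00222-013-0448-1, arXiv:2303.04373, JetchevSkinnerWan2017, Greenberg2016
[support, PRINT ∧ MEMO — the two-variable passage, DOSSIER section 48.3 (W)(H)(R)(S)(F)] granted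
crux A at all X9 Heegner frames, the one-sided inequality k+k1+k2+k3 <= 0 follows for every
BCS-admissible pair: (W) BCS25 Prop 5.2.1 two-variable lower containment I ⊆ (L) in Λ_K^ur (Wan 2015
+ Hsieh mu(L^BDP)=0; no (sur)); (H) Howard-form ⇒ Greenberg-form anticyclotomic divisibility before
inverting p (BCK21 Thm 5.2 / BCS25 Thm 4.1.3) at (W,K) and (W^{dF},K), with pi^-(L) =
L^BDP-product·unit (CGS23 1.4.5 / JSW17 3.4.2) nonzero (CGS23 1.3.1); (R) SU14 Lemma 3.1.7 rigidity
⇒ I = (L) in Λ_K; (S) cyclotomic specialisation: SU14 3.2.8/3.2.11 + the equality pi^+(ch) =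
ch(X/I^-X) from no pseudo-null submodule (Gre16 Prop 4.1.1(b), hypotheses discharged by KOLY memo
5.8.A/5.8.B) and pi^+(L) = L_p-products (CGS23 Prop 1.2.4); (F) Shapiro ch^+(X(A/K_inf^+)) = ch
X(A/Q_inf)·ch X(A^K/Q_inf) (CGS23 Prop 2.2.1) ⇒ (g g_K g_F g_KF) ⊇-direction ⇒ Σk <= 0 in the
currency of BCS Thm 1.1.2(a). The prover builds K = Q(√dK) as a NumberField with discr K = dK and
the Heegner hypotheses of crux A from BCSAdmissiblePair (disc)(Heeg)(spl)(ii). Beyond print: no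
(memo algebra 5.8.A/B/D referee PASS v5); formali -/
@[route_item "route-BirchSwinnertonDyer-SignedBalanceX9"]
def UpperOfHowardContainment : Prop :=
  HowardContainmentAnyClassNumber → FourTermDefectUpperX9

-- parent: FourTermDefectUpperX9 · glue (gen 1)
/--     item stmt-BirchSwinnertonDyer-24709 · support · rank 203 · closed · proved by Summit.BirchSwinnertonDyer.BirchSwinnertonDyer.Rank1Residual.SignedBalanceSplit.upperOfSplit_holds (planner)
    parent: FourTermDefectUpperX9 · GLUE: children ⟹ parent · by planner
modus ponens: crux A (shared stmt-23161) and the PRINT∧MEMO passage UpperOfHowardContainment give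
FourTermDefectUpperX9 (DOSSIER §48.3 unification datum; memo 5.8.C STEP 1) -/
@[route_item "route-BirchSwinnertonDyer-SignedBalanceX9"]
def UpperOfSplit : Prop :=
  HowardContainmentAnyClassNumber → UpperOfHowardContainment → FourTermDefectUpperX9

-- `UpperOfSplit` holds: proved by `Summit.BirchSwinnertonDyer.BirchSwinnertonDyer.Rank1Residual.SignedBalanceSplit.upperOfSplit_holds` (its module imports this route file, so no `_holds` link can be stated here).

/-- item stmt-BirchSwinnertonDyer-24460 · aside · rank 3 · open · by planner
why it might fail: class-wide = Greenberg Conj. 1.11 for the (again X9) twists; at fixed p no theorem gives even one twist with mu(L_p(E^d)) = 0 (Prasanna 2010 p.400 for unit values; Ono-Skinner/Chida: almost all p); the small image could force p | theta(E^d) on the whole admissible orbit.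
sources: Greenberg1999LNM1716, doi:10.4153/cjm-2010-023-2, OnoSkinner1998, arXiv:2405.00270
[crux] the tree conjecture (alpha-prime) `Rank1Residual.TwistedAnalyticMuZeroOnClassX9` by name:
every X9 pair (W,p) has a BCS-admissible (dK,dF) such that each of the three twists W^dK, W^dF,
W^(dK dF) has a p-adic unit among the coefficients of its p-adic L-function (analytic mu = 0 of the
twists; per pair a finite modular-symbol certificate). [difficulty: open-problem] -/
@[route_item "route-BirchSwinnertonDyer-SignedBalanceX9"]
def TwistedAnalyticMuZeroX9 : Prop :=
  Summit.BirchSwinnertonDyer.BirchSwinnertonDyer.Rank1Residual.TwistedAnalyticMuZeroOnClassX9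

/-- item stmt-BirchSwinnertonDyer-19266 · aside · rank 9 · open · by planner
sources: BCDTJAMS2001 Thm A, Summits/BirchSwinnertonDyer/BirchSwinnertonDyer/Theses/SmallImageMuTransfer.lean (stmt-19266)
[support] modularity of E/ℚ as parametrisation data (Breuil–Conrad–Diamond–Taylor 2001 Thm A), BY
NAME — conjunct of OrdPublishedInputsAtTwo (19149; Literature.Uncategorized.OrdPublishedInputsAtTwo
l.26); same content, filed so the head constant is item-stated (#15c one rule; cite_only dep) -/
@[route_item "route-BirchSwinnertonDyer-SignedBalanceX9"]
def ModularParametrizationSupply : Prop :=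
  Literature.NumberTheory.EllipticCurves.ModularForms.nonempty_modularParametrizationData

/-- item stmt-BirchSwinnertonDyer-19273 · aside · rank 9 · open · by planner
sources: BCDTJAMS2001, Wiles1995, Summits/BirchSwinnertonDyer/BirchSwinnertonDyer/Theses/SmallImageMuTransfer.lean (stmt-19273)
[support] entire continuation of L(E/ℚ, s) (modularity: Breuil–Conrad–Diamond–Taylor 2001 Thm A +
Hecke/Shimura), BY NAME — conjunct of MultConversePublishedInputsAtTwo (19185); same content, filed
so the head constant is item-stated (#15c one rule; cite_only dep) -/
@[route_item "route-BirchSwinnertonDyer-SignedBalanceX9"]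
def EntireLFunctionRat : Prop :=
  WeierstrassCurve.hasEntireLFunction_rat

/-- item stmt-BirchSwinnertonDyer-19290 · aside · rank 9 · closed · proved by Summit.BirchSwinnertonDyer.BirchSwinnertonDyer.Theorems.SignedLowerHalves.RealPeriodUnitPlusPeriod_proof (prover) · by operator
sources: GreenbergVatsal2000 Rem 3.4, AbbesUllmo1996 Thm A, Summits/BirchSwinnertonDyer/BirchSwinnertonDyer/Theses/SmallImageMuTransfer.lean (stmt-19290)
[support] Néron period vs. plus period of the newform: Ω_E = u · Ω⁺_f with u a p-adic unit, p ≥ 5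
(Manin constant: Mazur 1978 Cor. 4.1, Edixhoven 1991 Prop. 2, Abbes–Ullmo 1996 Thm. A;
Greenberg–Vatsal 2000 Rem. 3.4) — conjunct of PublishedSignedInputs
(stmt-BirchSwinnertonDyer-19005), BY NAME; same content, filed as a split child so the head constant
is item-stated (gate5 #15c one rule; readiness rule 2026-08-15: cite_only dep declared by the
route); no statement / closes / tribunal change -/
@[route_item "route-BirchSwinnertonDyer-SignedBalanceX9"]
def RealPeriodUnitPlusPeriod : Prop :=
  Literature.NumberTheory.EllipticCurves.realPeriodRat_eq_unit_mul_plusPeriod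

/-- `RealPeriodUnitPlusPeriod` holds: proved by `Summit.BirchSwinnertonDyer.BirchSwinnertonDyer.Theorems.SignedLowerHalves.RealPeriodUnitPlusPeriod_proof`. -/
theorem RealPeriodUnitPlusPeriod_holds : RealPeriodUnitPlusPeriod := _root_.Summit.BirchSwinnertonDyer.BirchSwinnertonDyer.Theorems.SignedLowerHalves.RealPeriodUnitPlusPeriod_proof

/-- item stmt-BirchSwinnertonDyer-19459 · aside · rank 9 · open · by planner
sources: arXiv:2405.00270 Thm 1.1.2(a), Summits/BirchSwinnertonDyer/BirchSwinnertonDyer/Theses/SmallImageMuTransfer.lean (stmt-19459)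
[support, cite-only] Burungale–Castella–Skinner 2025 Thm 1.1.2 (a) (arXiv:2405.00270v2 p. 2): for
E/ℚ, p ≥ 5 good ordinary with E[p] irreducible, the cyclotomic characteristic ideal equals (L_p(E))
in Λ ⊗ ℚ_p (integrally given μ = 0 on both sides) — conjunct of PublishedInputsX9
(stmt-BirchSwinnertonDyer-19632, text FROZEN REF v8-3), BY NAME; same content, filed as a split
child so the head constant is item-stated (readiness rule 2026-08-15 / gate5 #15c: a cite_only dep
must be declared by the route); no crux statement / closes / tribunal change; never staffed for
proof (cite-only, to be HELD), closes only when the named fact becomes a theorem -/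
@[route_item "route-BirchSwinnertonDyer-SignedBalanceX9"]
def BCSCharIdealEqPadicLFunction : Prop :=
  Literature.NumberTheory.EllipticCurves.burungale_castella_skinner_charIdeal_eq_padicLFunction

/-- item stmt-BirchSwinnertonDyer-19460 · aside · rank 9 · closed · proved by Summit.BirchSwinnertonDyer.BirchSwinnertonDyer.Theorems.InputsDeskTwoTurnkey.smallImageMuTransfer_greenbergCharValueRankZero (prover) · by planner
sources: GreenbergLNM1716 Thm 4.1, Summits/BirchSwinnertonDyer/BirchSwinnertonDyer/Theses/SmallImageMuTransfer.lean (stmt-19460)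
[support, cite-only] Greenberg LNM 1716 Thm 4.1 (p. 102; held copy
book:coatesnd-arithmetic-theory-elliptic-curves chunk p0091): the rank-0 Euler-characteristic
formula f_E(0) ~ #Sel · ∏c_v · #Ẽ(𝔽_p)² / #E(ℚ)_tors² at good ordinary p — conjunct of
PublishedInputsX9 (stmt-BirchSwinnertonDyer-19632, text FROZEN REF v8-3), BY NAME; same content,
filed as a split child so the head constant is item-stated (readiness rule 2026-08-15 / gate5 #15c:
a cite_only dep must be declared by the route); no crux statement / closes / tribunal change; never
staffed for proof (cite-only, to be HELD), closes only when the named fact becomes a theorem -/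
@[route_item "route-BirchSwinnertonDyer-SignedBalanceX9"]
def GreenbergCharValueRankZero : Prop :=
  Literature.NumberTheory.EllipticCurves.greenberg_charValue_rankZero

/-- `GreenbergCharValueRankZero` holds: proved by `Summit.BirchSwinnertonDyer.BirchSwinnertonDyer.Theorems.InputsDeskTwoTurnkey.smallImageMuTransfer_greenbergCharValueRankZero`. -/
theorem GreenbergCharValueRankZero_holds : GreenbergCharValueRankZero := _root_.Summit.BirchSwinnertonDyer.BirchSwinnertonDyer.Theorems.InputsDeskTwoTurnkey.smallImageMuTransfer_greenbergCharValueRankZero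

/-- item stmt-BirchSwinnertonDyer-19468 · aside · rank 9 · open · by planner
sources: Schneider1985 Thm 2', BalakrishnanMullerStein2015 Thm 1.7, Summits/BirchSwinnertonDyer/BirchSwinnertonDyer/Theses/SmallImageMuTransfer.lean (SchneiderOrderCharGenerator)
[aside] Schneider 1985 Thm 2′ (p. 342) / Thm 7 (p. 371) with Perrin-Riou 1992 §3.4.2–3.4.3
(transcribed from Balakrishnan–Müller–Stein 2015 Thm 1.7): ord_T of a characteristic generator =
rank and its leading term up to a unit, given Schneider's non-degeneracy — conjunct 4 of
PublishedInputsX9, inside the split child IwasawaLeadingTermFactsX9; item-stated BY NAME here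
because split.k_max = 7 from this seat forced two facts into one child. Banked context (aside):
never staffed; no crux statement / closes / tribunal change. -/
@[route_item "route-BirchSwinnertonDyer-SignedBalanceX9"]
def SchneiderOrderCharGenerator : Prop :=
  Literature.NumberTheory.EllipticCurves.Schneider1985_order_charGenerator

/-- item stmt-BirchSwinnertonDyer-19469 · aside · rank 9 · open · by planner
sources: PerrinRiou1987 Thm 1.3, Cor 1.8, Summits/BirchSwinnertonDyer/BirchSwinnertonDyer/Theses/SmallImageMuTransfer.lean (stmt-19469)
[aside] Perrin-Riou 1987 Thm 1.3, (1.1) and §1.4 Cor. 1.8 (p-adic Gross–Zagier): rank-one leading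
terms — conjunct 5 of PublishedInputsX9, inside the split child IwasawaLeadingTermFactsX9;
item-stated BY NAME here because split.k_max = 7 from this seat forced two facts into one child.
Banked context (aside): never staffed; no crux statement / closes / tribunal change. -/
@[route_item "route-BirchSwinnertonDyer-SignedBalanceX9"]
def PerrinRiouRankOneLeadingTerms : Prop :=
  Literature.NumberTheory.EllipticCurves.perrinRiou_rankOne_leadingTerms

/-- item stmt-BirchSwinnertonDyer-19632 · support · rank 9 · open · by planner
sources: arXiv:2405.00270, Greenberg1999LNM1716, Schneider1985, PerrinRiou1993
[support] The eight PUBLISHED named facts the kernel bridge `bsdpOnClassX9_of_katoMuTransfer`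
consumes, as one conjunction of the tree's cited Props: BCS 2025 Thm 1.1.2 (a) (characteristic ideal
= (L_p) given μ = 0 and Kato), Greenberg 1999 Thm 4.1 (rank-0 Euler characteristic), the real period
vs plus period unit relation, Schneider 1985 (order of the characteristic power series), Perrin-Riou
1987 rank-one leading terms, modularity (parametrisation), entire L-function over ℚ, rank = analytic
rank ≤ 1 (Gross–Zagier–Kolyvagin). Provable-now means: discharge conjunct by conjunct as the
`_holds` theorems land; the non-`_odd` Schneider/Perrin-Riou facts are the bridge's exact binder
types. [difficulty: provable-now] -/
@[route_item "route-BirchSwinnertonDyer-SignedBalanceX9", crux]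
def PublishedInputsX9 : Prop :=
  Literature.NumberTheory.EllipticCurves.burungale_castella_skinner_charIdeal_eq_padicLFunction ∧ Literature.NumberTheory.EllipticCurves.greenberg_charValue_rankZero ∧ Literature.NumberTheory.EllipticCurves.realPeriodRat_eq_unit_mul_plusPeriod ∧ Literature.NumberTheory.EllipticCurves.Schneider1985_order_charGenerator ∧ Literature.NumberTheory.EllipticCurves.perrinRiou_rankOne_leadingTerms ∧ Literature.NumberTheory.EllipticCurves.ModularForms.nonempty_modularParametrizationData ∧ WeierstrassCurve.hasEntireLFunction_rat ∧ Literature.NumberTheory.EllipticCurves.rank_eq_analyticRank_of_analyticRank_le_one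

/-- item stmt-BirchSwinnertonDyer-24461 · support (kind.auto-crux: conjecture-grade) · rank 1 · closed · proved by Summit.BirchSwinnertonDyer.BirchSwinnertonDyer.Rank1Residual.SignedBalance.assembly_holds (planner) · by planner
why it might fail: auto-crux — conjecture-grade statement (statement references the registered conjecture Summit.BirchSwinnertonDyer.BirchSwinnertonDyer.Rank1Residual.IntegralMainConjectureOnClassX9); it is open, so it may simply be false
sources: arXiv:2405.00270, MazurTateTeitelbaum1986
[assembly] the (im)-free separation: FourTermDefectBalanceX9 -> AnalyticMuZeroX9 ->
TwistedAnalyticMuZeroX9 -> PublishedInputsX9 -> IntegralMainConjectureOnClassX9 (PROVED in the seat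
folder: sign lemma `defect_nonneg_of_unit_coeff`, `squarefree_mul_of_admissible`, twist stability
x3, BCS (a) x4, omega). -/
@[route_item "route-BirchSwinnertonDyer-SignedBalanceX9"]
def Assembly : Prop :=
  FourTermDefectBalanceX9 → AnalyticMuZeroX9 → TwistedAnalyticMuZeroX9 → PublishedInputsX9 → Summit.BirchSwinnertonDyer.BirchSwinnertonDyer.Rank1Residual.IntegralMainConjectureOnClassX9

-- `Assembly` holds: proved by `Summit.BirchSwinnertonDyer.BirchSwinnertonDyer.Rank1Residual.SignedBalance.assembly_holds` (its module imports this route file, so no `_holds` link can be stated here).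

/-- item stmt-BirchSwinnertonDyer-19921 · aside · rank 9 · open · by operator
sources: GrossZagier1986, KolyvaginEulerSystems1990, Summits/BirchSwinnertonDyer/BirchSwinnertonDyer/Theses/SmallImageMuTransfer.lean (stmt-19921)
[support] The one PUBLISHED input the halves-glue consumes: Gross–Zagier–Kolyvagin, rank = analytic
rank for analytic rank ≤ 1 with Ш finite (tree named fact
rank_eq_analyticRank_of_analyticRank_le_one; used by bsdp_of_missingPPartAt to turn Miller's last
clause into BSD(E,2)). Carried as a displayed PUB hypothesis; never counted as progress. The further
PRINT of the roads to the two halves (Greenberg Thm-4.1 analogues at a multiplicative prime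
thm41Analogue_charValue_rankZero_numberField_anyPrime / …_split_baseChange_anyPrime, modularity) and
the referee-passed MEMO inputs (Kato ⊗ℚ at a multiplicative 2:
X5.O1.KatoMultiplicativeDivisibilityRat W 2, HOME mult/PROOF-MULT.md RC-2; Greenberg–Stevens at 2:
greenberg_stevens W 2, mult/PROOF-GS2.md RC-4) enter the LINES under the halves (bridge
multiplicativeRankZeroAtTwo_of_muRoad, p409679), not this glue. -/
@[route_item "route-BirchSwinnertonDyer-SignedBalanceX9"]
def RankEqAnalyticRankLeOne : Prop :=
  Literature.NumberTheory.EllipticCurves.rank_eq_analyticRank_of_analyticRank_le_one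

/-- item stmt-BirchSwinnertonDyer-21379 · support · rank 9 · open · by planner
why it might fail: cite-only named fact typed verbatim in Literature/NumberTheory/QuadraticFields/HurwitzClassNumberCongruences.lean; fails only on mis-transcription.
sources: arXiv:2203.11273 Thm 1, BeckwithRaumRichter2022
[support; PRINT INPUT stated ALONE (typing rule T12) — HELD like HsiehAnyLevelInput /
LiuZhangZhangAdditiveInput: the tree's named fact
`Literature.NumberTheory.QuadraticFields.BRR2022_thm_1`
(Literature/NumberTheory/QuadraticFields/HurwitzClassNumberCongruences.lean, p553658, cite item
wi-81822)] Beckwith–Raum–Richter, Adv. Math. 409 (2022) 108663, Theorem 1: for a prime ℓ > 3, a ≥ 1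
and b ∈ ℤ with −b a square mod a, a non-holomorphic Ramanujan-type congruence H(an+b) ≡ 0 (mod ℓ)
for all integers n forces ℓ ∣ b. (The PNAS-2020 companion «ℓ ∣ a», `BRR2020_thm_1`, is NOT needed by
the supply argument and is deliberately not put into the cone.) [cite: BeckwithRaumRichter2022, Thm
1; held text paper:arxiv-2203.11273 p0002 L38–46] -/
@[route_item "route-BirchSwinnertonDyer-SignedBalanceX9", crux]
def BRR2022Thm1 : Prop :=
  Literature.NumberTheory.QuadraticFields.BRR2022_thm_1

/-- item stmt-BirchSwinnertonDyer-24567 · support (kind.auto-crux: conjecture-grade) · rank 9 · closed · proved by Summit.BirchSwinnertonDyer.BirchSwinnertonDyer.Rank1Residual.SignedBalanceUpper.signedBalanceX9_assemblyViaUpper (planner) · by planner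
why it might fail: auto-crux — conjecture-grade statement (statement references the registered conjecture Summit.BirchSwinnertonDyer.BirchSwinnertonDyer.Rank1Residual.IntegralMainConjectureOnClassX9); it is open, so it may simply be false
sources: arXiv:2405.00270 Thm 1.1.2(a), Summits/BirchSwinnertonDyer/BirchSwinnertonDyer/Theorems/SignedBalanceX9Assembly.lean
[support/glue] FourTermDefectUpperX9 -> AnalyticMuZeroX9 -> TwistedAnalyticMuZeroX9 ->
PublishedInputsX9 -> IntegralMainConjectureOnClassX9: the Assembly with the balance replaced by its
one-sided (upper) half. PROVED (seat folder SketchG_proof.lean rc 0 sorries 0; lands as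
Theorems/SignedBalanceX9AssemblyViaUpper.lean): BCS (a) data at the four curves, sign lemma k_i >= 0
(x4), upper inequality, omega. Size S. -/
@[route_item "route-BirchSwinnertonDyer-SignedBalanceX9"]
def AssemblyViaUpper : Prop :=
  FourTermDefectUpperX9 → AnalyticMuZeroX9 → TwistedAnalyticMuZeroX9 → PublishedInputsX9 → Summit.BirchSwinnertonDyer.BirchSwinnertonDyer.Rank1Residual.IntegralMainConjectureOnClassX9

-- `AssemblyViaUpper` holds: proved by `Summit.BirchSwinnertonDyer.BirchSwinnertonDyer.Rank1Residual.SignedBalanceUpper.signedBalanceX9_assemblyViaUpper` (its module imports this route file, so no `_holds` link can be stated here).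

/-- item stmt-BirchSwinnertonDyer-25218 · support (kind.auto-crux: conjecture-grade) · rank 9 · closed · proved by Summit.BirchSwinnertonDyer.BirchSwinnertonDyer.Rank1Residual.SignedBalanceCoprime.signedBalanceX9_assemblyViaUpperCoprime (planner) · by planner
why it might fail: auto-crux — conjecture-grade statement (statement references the registered conjecture Summit.BirchSwinnertonDyer.BirchSwinnertonDyer.Rank1Residual.IntegralMainConjectureOnClassX9); it is open, so it may simply be false
sources: arXiv:2405.00270 Thm 1.1.2(a), Summits/BirchSwinnertonDyer/BirchSwinnertonDyer/Theorems/SignedBalanceX9Assembly.lean, Summits/BirchSwinnertonDyer/BirchSwinnertonDyer/Theorems/SignedBalanceX9AssemblyViaUpper.lean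
[support/glue] FourTermDefectUpperCoprimeX9 -> AnalyticMuZeroX9 -> TwistedAnalyticMuZeroCoprimeX9 ->
PublishedInputsX9 -> IntegralMainConjectureOnClassX9: the one-sided separation run at the COPRIME
frame supplied by the twisted crux (its class-number clause is handed to the upper inequality); BCS
(a) data at the four curves, sign lemma k_i ≥ 0 (SignedBalance.defect_nonneg_of_unit_coeff) ×4, k +
k1 + k2 + k3 ≤ 0, omega. PROVED sorry-free in the seat folder (line7/Sketch7.lean, lean rc 0); lands
as Theorems/SignedBalanceX9AssemblyViaUpperCoprime.lean. -/
@[route_item "route-BirchSwinnertonDyer-SignedBalanceX9", crux]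
def AssemblyViaUpperCoprime : Prop :=
  FourTermDefectUpperCoprimeX9 → AnalyticMuZeroX9 → TwistedAnalyticMuZeroCoprimeX9 → PublishedInputsX9 → Summit.BirchSwinnertonDyer.BirchSwinnertonDyer.Rank1Residual.IntegralMainConjectureOnClassX9

-- `AssemblyViaUpperCoprime` holds: proved by `Summit.BirchSwinnertonDyer.BirchSwinnertonDyer.Rank1Residual.SignedBalanceCoprime.signedBalanceX9_assemblyViaUpperCoprime` (its module imports this route file, so no `_holds` link can be stated here).

/-- item stmt-BirchSwinnertonDyer-25233 · support · rank 9 · open · by planner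
sources: arXiv:2505.08710 Cor 4.6, Summits/BirchSwinnertonDyer/BirchSwinnertonDyer/Theses/PrintX9.lean (stmt-25233, rev 18)
[support, cite-only, by name] Mastella–Zerman 2026 Cor. 4.6 (arXiv:2505.08710) = Howard's Thm B
divisibility char_Λ(X_tors) ∣ I(ℋ_∞)² (with 𝐒 torsion-free of rank one, X of rank one) under
`MastellaZerman2026.Hypotheses` (E[p] irreducible + scalar in the image, p ∤ h_K·disc, Heegner,
anticyclotomic): the VERBATIM BODY of the tree named fact
`MastellaZerman2026.cor46_howardDivisibility_of_scalarImage` at universe 0 (K : Type) —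
definitionally equal to `cor46_howardDivisibility_of_scalarImage.{0}` (the fact is
universe-polymorphic, so the item states its body, not the constant; rev 18). The PRINT input of the
p ∤ h_K regime of the deciding crux HowardContainmentLightFrameOfPrint (X9 discharge
`X9.heegnerContainment_of_cor46`, the route's BC5 witness; line stub s1 proved from it, p596622).
Filed so that `h46` is a BINDER of `closes`. Never staffed; closes only if the fact becomes a
theorem (then `fun … => cor46_holds.{0} …`). -/
@[route_item "route-BirchSwinnertonDyer-SignedBalanceX9", crux]
def MastellaZermanHowardDivisibility : Prop :=
  ∀ (N : ℕ) [NeZero N] (W : WeierstrassCurve ℚ) [W.IsGloballyMinimal] (K : Type) [Field K] [NumberField K] (p : ℕ) [Fact p.Prime] (κ : Literature.NumberTheory.EllipticCurves.ZpExtension K p) (γ : Field.absoluteGaloisGroup K) (jbar : AlgebraicClosure K →+* ℂ), Literature.NumberTheory.EllipticCurves.MastellaZerman2026.Hypotheses N W K p κ γ → ∀ (D : (W.baseChange K).LambdaAdicSelmerData κ γ) (F : Literature.NumberTheory.EllipticCurves.HeegnerFamily N W K κ jbar) (X : (W.baseChange K).SelmerDualData κ γ), (Module.Finite (Literature.NumberTheory.EllipticCurves.IwasawaAlgebra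 p) D.S ∧ NoZeroSMulDivisors (Literature.NumberTheory.EllipticCurves.IwasawaAlgebra p) D.S ∧ Module.finrank (Literature.NumberTheory.EllipticCurves.IwasawaAlgebra p) D.S = 1) ∧ (Module.Finite (Literature.NumberTheory.EllipticCurves.IwasawaAlgebra p) X.X ∧ Module.finrank (Literature.NumberTheory.EllipticCurves.IwasawaAlgebra p) X.X = 1 ∧ Literature.NumberTheory.EllipticCurves.Module.charIdeal (Literature.NumberTheory.EllipticCurves.IwasawaAlgebra p) (Submodule.torsion (Literature.NumberTheory.EllipticCurves.IwasawaAlgebra p) X.X) ∣ Literature.NumberTheory.EllipticCurves.heegnerCharIdeal D F ^ 2)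

/-- item stmt-BirchSwinnertonDyer-26942 · support · rank 9 · open · by planner
why it might fail: cite-only conjunction of published theorems already typed in the tree; fails only if one of the typed statements mis-transcribes its source (then the fact is re-typed and this bundle superseded).
sources: arXiv:2405.00270 Prop 5.2.1, Thm 4.1.3, Cor 4.1.4, Prop 4.2.2, (5.3), Hsieh2014 Thm B, SkinnerUrban2014 Prop 3.2.3, arXiv:2303.04373 (CastellaGrossiSkinner) Thm 2.4.1, 2.4.2, 6.5.3, Prop 3.3.1, Thm 7.2.3, JetchevSkinnerWan2017 Thm 3.3.1, DOSSIER §48.3 (pub/bsd-print-x9)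
[support · cite-only bundle v1, BY NAME] The DOSSIER §48.3 passage facts that already exist as named
tree facts, stated as bare constants so that a kernel proof of FourTermDefectUpperCoprimeX9OfPrint
can consume them by name: (W) BCS25 Prop 5.2.1 product divisibilities + display (5.3) + Cor
4.1.4/Thm 4.1.3 (guarded ordinary ⇔ Greenberg passage) + Prop 4.2.2 (unit content of the Greenberg
p-adic L-function, minus root); Hsieh 2014 Thm B (mu(L^BDP)=0); (F) SU14 Prop 3.2.3 (Shapiro); (H)
CGS Thm 2.4.2/Lemma 2.4.4 (Greenberg p-adic L), Thm 2.4.1 (two-variable Hida–Rankin II), Thm 6.5.3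
(BDP main conjecture form), Prop 3.3.1 + Thm 7.2.3 (Perrin-Riou side); JSW17 Thm 3.3.1
(anticyclotomic control, general). Residual facts NOT yet typed (to arrive as a second bundle when
lit types them): Gre16 Prop 4.1.1(b), SU14 Prop 3.2.11, CGS23 Prop 2.2.1, and the CGS23
1.2.4/1.3.1/1.4.5 ↔ tree-decl map. Proved tree theorems (SU14 Lemma 3.1.7 =
eq_span_singleton_of_le_of_mem_map; Cor 3.2.9 = corollary329_*) need no binder. -/
@[route_item "route-BirchSwinnertonDyer-SignedBalanceX9", crux]
def PassagePrintFactsX9V1 : Prop :=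
  Literature.NumberTheory.EllipticCurves.BurungaleCastellaSkinner2025.prop521_baseChange_product_divisibilities ∧ Literature.NumberTheory.EllipticCurves.BurungaleCastellaSkinner2025.cor414_product_ord_localised_iff_greenberg_localised_guarded ∧ Literature.NumberTheory.EllipticCurves.BurungaleCastellaSkinner2025.thm413_ord_torsion_dvd_iff_greenberg_torsion_dvd_guarded ∧ Literature.NumberTheory.EllipticCurves.BurungaleCastellaSkinner2025.display53_prod_charIdeal_le_prod_padicLFunction ∧ Literature.NumberTheory.EllipticCurves.BurungaleCastellaSkinner2025.prop422_greenbergAnyRoot_hasUnitContent_minus ∧ Literature.NumberTheory.EllipticCurves.Hsieh2014.thmB_exists_isHsiehLFunction_coeff_norm_eq_one ∧ Literature.NumberTheory.EllipticCurves.SkinnerUrban2014.prop323_XAc_equiv_XBigDecomp ∧ Literature.NumberTheory.EllipticCurves.CastellaGrossiSkinner2025.thm242_lemma244_exists_isGreenbergLFunction ∧ Literature.NumberTheory.EllipticCurves.CastellaGrossiSkinner2025.thm241_exists_isHidaRankinLFunctionII ∧ Literature.NumberTheory.EllipticCurves.CastellaGrossiSkinner2025.thm653_exists_isBDPLFunction_isTorsion_charIdeal_map_eq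 ∧ Literature.NumberTheory.EllipticCurves.CastellaGrossiSkinner2025.prop331_nonempty_linearEquiv_prod ∧ Literature.NumberTheory.EllipticCurves.CastellaGrossiSkinner2025.thm723_charIdeal_eq_padicLFunction_mul ∧ Literature.NumberTheory.EllipticCurves.JetchevSkinnerWan2017.thm331_anticyclotomicControl_general

/-- item stmt-BirchSwinnertonDyer-26943 · support · rank 9 · open · by planner
why it might fail: the passage (W)(H)(R)(S)(F) at coprime frames still needs the 3–4 untyped residual facts (Gre16 4.1.1(b), SU14 3.2.11, CGS 2.2.1); until they are binders a kernel proof may stall exactly there — then re-type with bundle v2.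
sources: MastellaZerman2026 Cor 4.6, arXiv:2405.00270 §4–5, DOSSIER §48.3
[support · print passage re-typed BY NAME (bsd-print-x9 plan g8 courtesy 03:29Z/04:20Z; PrintX9 rev
17–19 precedent)] The coprime four-term upper inequality FourTermDefectUpperCoprimeX9 (stmt-25217)
with its print inputs as explicit hypotheses: Mastella–Zerman 2026 Cor 4.6 (Howard divisibility for
scalar-containing image, class X9) and the §48.3 passage bundle v1. 25217 implies it trivially (fun
_ _ => h), so any proof of 25217 closes it; conversely a kernel proof can now cite MZ and the
passage facts by name. Size: print/formalisation XL (unchanged). (v11: hypotheses spelled out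
verbatim = the bodies of MastellaZermanHowardDivisibility and PassagePrintFactsX9V1, so the decl is
order-independent in the rendered file; closes feeds it hMZ hPass by delta-unfolding.) -/
@[route_item "route-BirchSwinnertonDyer-SignedBalanceX9", crux]
def FourTermDefectUpperCoprimeX9OfPrint : Prop :=
  (∀ (N : ℕ) [NeZero N] (W : WeierstrassCurve ℚ) [W.IsGloballyMinimal] (K : Type) [Field K] [NumberField K] (p : ℕ) [Fact p.Prime] (κ : Literature.NumberTheory.EllipticCurves.ZpExtension K p) (γ : Field.absoluteGaloisGroup K) (jbar : AlgebraicClosure K →+* ℂ), Literature.NumberTheory.EllipticCurves.MastellaZerman2026.Hypotheses N W K p κ γ → ∀ (D : (W.baseChange K).LambdaAdicSelmerData κ γ) (F : Literature.NumberTheory.EllipticCurves.HeegnerFamily N W K κ jbar) (X : (W.baseChange K).SelmerDualData κ γ), (Module.Finite (Literature.NumberTheory.EllipticCurves.IwasawaAlgebra p) D.S ∧ NoZeroSMulDivisors (Literature.NumberTheory.EllipticCurves.IwasawaAlgebra p) D.S ∧ Module.finrank (Literature.NumberTheory.EllipticCurves.IwasawaAlgebra p) D.S = 1) ∧ (Module.Finite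 (Literature.NumberTheory.EllipticCurves.IwasawaAlgebra p) X.X ∧ Module.finrank (Literature.NumberTheory.EllipticCurves.IwasawaAlgebra p) X.X = 1 ∧ Literature.NumberTheory.EllipticCurves.Module.charIdeal (Literature.NumberTheory.EllipticCurves.IwasawaAlgebra p) (Submodule.torsion (Literature.NumberTheory.EllipticCurves.IwasawaAlgebra p) X.X) ∣ Literature.NumberTheory.EllipticCurves.heegnerCharIdeal D F ^ 2)) → (Literature.NumberTheory.EllipticCurves.BurungaleCastellaSkinner2025.prop521_baseChange_product_divisibilities ∧ Literature.NumberTheory.EllipticCurves.BurungaleCastellaSkinner2025.cor414_product_ord_localised_iff_greenberg_localised_guarded ∧ Literature.NumberTheory.EllipticCurves.BurungaleCastellaSkinner2025.thm413_ord_torsion_dvd_iff_greenberg_torsion_dvd_guarded ∧ Literature.NumberTheory.EllipticCurves.BurungaleCastellaSkinner2025.display53_prod_charIdeal_le_prod_padicLFunction ∧ Literature.NumberTheory.EllipticCurves.BurungaleCastellaSkinner2025.prop422_greenbergAnyRoot_hasUnitContent_minus ∧ Literature.NumberTheory.EllipticCurves.Hsieh2014.thmB_exists_isHsiehLFunction_coeff_norm_eq_one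 ∧ Literature.NumberTheory.EllipticCurves.SkinnerUrban2014.prop323_XAc_equiv_XBigDecomp ∧ Literature.NumberTheory.EllipticCurves.CastellaGrossiSkinner2025.thm242_lemma244_exists_isGreenbergLFunction ∧ Literature.NumberTheory.EllipticCurves.CastellaGrossiSkinner2025.thm241_exists_isHidaRankinLFunctionII ∧ Literature.NumberTheory.EllipticCurves.CastellaGrossiSkinner2025.thm653_exists_isBDPLFunction_isTorsion_charIdeal_map_eq ∧ Literature.NumberTheory.EllipticCurves.CastellaGrossiSkinner2025.prop331_nonempty_linearEquiv_prod ∧ Literature.NumberTheory.EllipticCurves.CastellaGrossiSkinner2025.thm723_charIdeal_eq_padicLFunction_mul ∧ Literature.NumberTheory.EllipticCurves.JetchevSkinnerWan2017.thm331_anticyclotomicControl_general) → FourTermDefectUpperCoprimeX9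

/-- item stmt-BirchSwinnertonDyer-26944 · support · rank 9 · closed · proved by Summit.BirchSwinnertonDyer.BirchSwinnertonDyer.Theorems.SignedBalanceX9CoprimeFrame.twistedAnalyticMuZeroCoprimeX9OfPrint_proof (prover) · by planner
why it might fail: it cannot as typed (a landed theorem proves it); the open content it exposes is AnalyticMuZeroX9 (19630), an open problem (Greenberg Conj. 1.11 on X9).
sources: arXiv:2203.11273 Thm 1, Greenberg1999LNM1716 Conj 1.11, Summits/BirchSwinnertonDyer/BirchSwinnertonDyer/Theorems/SignedBalanceX9CoprimeFrameSupply.lean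
[support · re-typed BY NAME, LEAD sbx9-p1 turnkey 2026-08-28T05:42Z option (A)] The coprime twisted
analytic μ = 0 item TwistedAnalyticMuZeroCoprimeX9 (stmt-25216) with its inputs explicit: (K)
coprime split-discriminant frame supply ⇐ BRR 2022 Thm 1 (landed
coprimeSplitDiscriminantSupply_of_brr2022), (U) unit coefficient of the prime-to-p twist ⇐ Greenberg
μ_an = 0 ON X9 (item 19630) via X9.ClassX9.exists_twist, (F) unconditional
(stub_twistSideDiscriminantX9, p606505). Closable AT ONCE by
`Summit.BirchSwinnertonDyer.BirchSwinnertonDyer.Theorems.SignedBalanceX9CoprimeFrame.twistedAnalyticMuZeroCoprimeX9_of_publishedInputs`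
(p607118 + p607311). Honest label: 25216 has NO open content beyond 19630 + one print fact; this
decl records that in the cone. -/
@[route_item "route-BirchSwinnertonDyer-SignedBalanceX9", crux]
def TwistedAnalyticMuZeroCoprimeX9OfPrint : Prop :=
  Literature.NumberTheory.QuadraticFields.BRR2022_thm_1 → AnalyticMuZeroX9 → PublishedInputsX9 → TwistedAnalyticMuZeroCoprimeX9

-- `TwistedAnalyticMuZeroCoprimeX9OfPrint` holds: proved by `Summit.BirchSwinnertonDyer.BirchSwinnertonDyer.Theorems.SignedBalanceX9CoprimeFrame.twistedAnalyticMuZeroCoprimeX9OfPrint_proof` (its module imports this route file, so no `_holds` link can be stated here).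

/-! D-0027 §2.1 — DECIDING THEOREM (planner-authored via `route open/edit --closes-file`; by planner-bsd-idea-2-g4-0 2026-08-28T08:16:22Z):
its hypotheses are this route's items and its conclusion the registered leaf `Summit.BirchSwinnertonDyer.BirchSwinnertonDyer.Rank1Residual.BSDpOnClassX9` (rung K6, D-0061) (glue_lint), and it elaborates with this file. -/

@[closes "route-BirchSwinnertonDyer-SignedBalanceX9"] theorem closes (hAsmC : AssemblyViaUpperCoprime) (hUpP : FourTermDefectUpperCoprimeX9OfPrint)
    (hMZ : MastellaZermanHowardDivisibility) (hPass : PassagePrintFactsX9V1)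
    (hMu : AnalyticMuZeroX9) (hTwCP : TwistedAnalyticMuZeroCoprimeX9OfPrint) (hBRR : BRR2022Thm1)
    (hPub : PublishedInputsX9) (hSch : SchneiderX9RankOne) :
    Summit.BirchSwinnertonDyer.BirchSwinnertonDyer.Rank1Residual.BSDpOnClassX9 := by
  have hIMC := hAsmC (hUpP hMZ hPass) hMu (hTwCP hBRR hMu hPub) hPub
  obtain ⟨-, hGr, h5, hS, hPR, hmodP, hmodL, hGZK⟩ := hPub
  exact Summit.BirchSwinnertonDyer.BirchSwinnertonDyer.Rank1Residual.bsdpOnClassX9_of_integralMainConjectureOnClassX9 hGr h5 hS hPR hmodP hmodL hGZK hIMC hSch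

end Summit.BirchSwinnertonDyer.BirchSwinnertonDyer.Theses.SignedBalanceX9
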